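import Mathlib
import Summits.Ventures.HodgeRepro.Tier4.Common.AdelicPlaces
import Summits.Ventures.HodgeRepro.Tier4.Common.CompactOpenLevel
import Summits.Ventures.HodgeRepro.Tier4.Line1.LeftTypeOfMatrixCoeff
import Summits.Ventures.HodgeRepro.Tier4.Line1.RealisedSetting
import Summits.Ventures.HodgeRepro.Tier4.Line1.CocompactReduction
import Summits.Ventures.HodgeRepro.Tier4.Line1.IdentificationSplit

/-!
# Tier4/Line1/ArchMatrixCoeff — (S1b-INST) on the INSTANCE: the archimedean standard representation of `U(W)(𝔸_k)`,
the open subgroup `K_f(N) × G(k_∞)`, and Hecke finiteness for «level function × archimedean matrix coefficient» pairs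

Blind re-derivation cell `pub-hodge-repro`, Tier 4 (README §9–§10), seat t4-L1-p2 (gen 4), LINE L1.  Target tree path
`lean/Summits/Ventures/HodgeRepro/Tier4/Line1/ArchMatrixCoeff.lean`.  Imports typer-2's `AdelicPlaces` (`adComponentInf`),
`CompactOpenLevel` (`finPart`, `modSet` lemmas, `finCongr`, `isOpen_finCongr`, `levelK`, `preimage_levelK_eq`), this seat's
`LeftTypeOfMatrixCoeff` (`coeffFn`, `HasFiniteRankLeftType`, `exists_finset_specBlock_support_of_matrixCoeff`),
t4-L1-p3's `RealisedSetting` (`Setting.ofAdelic`), t4-L1-p5's `CocompactReduction` (`rationalPoints_countable`) and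
t4-L1-p4's `IdentificationSplit` (`FiniteSpectrum`).

WHAT THIS IS — the two tree objects that INSTANTIATE the (S1b) clause of L1's residual (CENSUS v14 §B (5): «each
`(tf γ).1` has a finite-rank left-`K γ`-type for an OPEN `K γ`», t4-L1-p1's `hdec`), and the theorem on the instance:

* `archEntry k w : 𝔸_k →+* ℂ` — the component at the infinite place `w` followed by Mathlib's isometric
  `extensionEmbedding w : w.Completion →+* ℂ`; CONTINUOUS (`continuous_archEntry`).
  `archMat W w : U(W)(𝔸_k) →* Matrix (Fin 4) (Fin 4) ℂ` — the ARCHIMEDEAN STANDARD REPRESENTATION at `w` (the matrix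
  entries of `g` read at `w`), a monoid homomorphism with continuous entries (`continuous_archMat_entry`); `archMat_apply`
  is `rfl`.  Its matrix coefficients `g ↦ archMat W w g i j` are the archimedean type `σ = std` of the residual's `tf`;
  higher types are matrix coefficients of further matrix-valued homomorphisms (tensor / symmetric powers), the generic
  theorem takes any.
* `finLevel W N : Subgroup U(W)(𝔸_k)` — the FINITE-PART principal congruence subgroup «`K_f(N) × G(k_∞)`»: `g` and
  `g⁻¹` congruent to `1 mod N` in every FINITE component, no archimedean condition (typer-2's `levelGL` with the
  `infPart = 0` clause dropped).  Its carrier is typer-2's `finCongr W N` (`coe_finLevel`), so it is OPEN in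
  `U(W)(𝔸_k)` for `N ≠ 0` (`isOpen_finLevel`, from `isOpen_finCongr`); it contains `K(N)` (`levelK_le_finLevel`) and its
  trace on the finite part is exactly `K(N)` (`finLevel_inf_finitePart`, from typer-2's `preimage_levelK_eq`).  THIS is the
  open `K` of p1's Hecke finiteness on the instance — the open subgroups of `U(W)(𝔸_k)` contain the archimedean identity
  component, and `finLevel` is the one cut out by a level `N` alone.
* THEOREMS on `Setting.ofAdelic` (t4-L1-p3's instance of the generic setting): `exists_spec_of_finiteRankLeftType` —
  for a family of test pairs whose first tests have a finite-rank left-`K γ`-type for open `K γ`, every Hecke choice has a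
  finite spectrum (`∃ spec, FiniteSpectrum … tf spec`; the v0.38 shape `exists_spec_of_type` plan-1 named, S13630) — and
  `exists_spec_of_archCoeff`: the same with `K γ = finLevel pl (N γ)` and `(tf γ).1 = coeffFn (archMat pl (w γ)) (i γ) (j γ)
  (ψ γ)` for left-`finLevel`-invariant test functions `ψ γ` — (S1b) is a THEOREM for «level-`N` function × archimedean
  matrix coefficient» pairs on L1's instance.

WHAT IS DISPLAYED, NOT PROVED.  `ψ γ` — a left-`finLevel pl (N γ)`-invariant TEST function — is a binder: a non-zero one
exists iff `finLevel` is compact iff the archimedean group `G(k_∞)` is compact (the definite plane at every real place);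
the generic `isTest_indicator_of_compactOpen` records the honest instance shape (`ψ = 1_K` for a compact open `K`).
Nothing is claimed about the dictionary `tf`, the seesaw identity (S1a), the isolation (S3′), or `P_T4`.  0 print.

JUNK TESTS.  `N = 0`: `modSet k 0 = {0}`, `finCongr W 0` is not open — every openness statement carries `hN : N ≠ 0`
(typer-2's guard, crit-1 S13707).  `w` at a real place: `extensionEmbedding` still lands in `ℂ` (real entries) — fine.
`archMat W w 1 = 1` (`map_one`).  The trivial family `tf γ = (0, 0)`: `ψ = 0` is a left-invariant test function and
`spec γ = ∅` — harmless, the theorems are about the SHAPE of `tf`, not its non-vanishing.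

Nothing here says anything about the status of the Hodge conjecture for CM abelian varieties, which is NOT proved
(HC_CM is NOT proved by anyone in this repository).
-/

set_option autoImplicit false

noncomputable section

namespace Summit.Ventures.HodgeRepro.Tier4.Line1

open NumberField Common MeasureTheory Topology

section ArchEntry

variable (k : Type) [Field k] [NumberField k]

/-- **the archimedean entry map at an infinite place `w`**: `𝔸_k →+* ℂ`, the component at `w` (typer-2's
`adComponentInf`) followed by Mathlib's `extensionEmbedding w : w.Completion →+* ℂ`. -/
def archEntry (w : InfinitePlace k) : Ad k →+* ℂ :=
  (InfinitePlace.Completion.extensionEmbedding w).comp (adComponentInf k w)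

/-- the component at an infinite place is continuous (a coordinate of the product). -/
theorem continuous_adComponentInf (w : InfinitePlace k) : Continuous (adComponentInf k w) :=
  (continuous_apply w).comp continuous_fst

/-- the archimedean entry map is continuous (`extensionEmbedding` is an isometry). -/
theorem continuous_archEntry (w : InfinitePlace k) : Continuous (archEntry k w) :=
  (InfinitePlace.Completion.isometry_extensionEmbedding w).continuous.comp (continuous_adComponentInf k w)

variable {k} (W : PlaneData k)

/-- **the archimedean standard representation at `w`**: `U(W)(𝔸_k) →* M₄(ℂ)`, the matrix of `g` with its entries read
at the infinite place `w`. -/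
def archMat (w : InfinitePlace k) : GA W →* Matrix (Fin 4) (Fin 4) ℂ :=
  ((archEntry k w).mapMatrix.toMonoidHom).comp ((Units.coeHom (M4 k)).comp (unitaryGroup W).subtype)

/-- the entries of the archimedean standard representation (`rfl`). -/
theorem archMat_apply (w : InfinitePlace k) (g : GA W) (i j : Fin 4) :
    archMat W w g i j = archEntry k w (GA.mat W g i j) := rfl

/-- the entry map `g ↦ g i j` of `U(W)(𝔸_k)` is continuous. -/
theorem continuous_mat_entry (i j : Fin 4) : Continuous fun g : GA W => GA.mat W g i j :=
  (Units.continuous_val.comp continuous_subtype_val).matrix_elem i j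

/-- **the entries of the archimedean standard representation are continuous**. -/
theorem continuous_archMat_entry (w : InfinitePlace k) (i j : Fin 4) :
    Continuous fun g : GA W => archMat W w g i j :=
  (continuous_archEntry k w).comp (continuous_mat_entry W i j)

end ArchEntry

section FinLevel

variable (k : Type) [Field k] [NumberField k]

/-- **the finite-part congruence entries mod `N`**: the adeles whose FINITE part lies in `∏_v N·𝓞_v` (no archimedean
condition) — an additive subgroup of `𝔸_k` closed under multiplication (typer-2's `congrSet` without its `infPart = 0`
clause). -/
def finCongrSet (N : ℕ) : AddSubgroup (Ad k) where
  carrier := {x | finPart k x ∈ modSet k N}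
  zero_mem' := by
    show finPart k 0 ∈ modSet k N
    rw [map_zero]
    exact zero_mem_modSet k N
  add_mem' := by
    intro x y hx hy
    show finPart k (x + y) ∈ modSet k N
    rw [map_add]
    exact add_mem_modSet k hx hy
  neg_mem' := by
    intro x hx
    show finPart k (-x) ∈ modSet k N
    rw [map_neg]
    exact neg_mem_modSet k hx

/-- membership in `finCongrSet`. -/
theorem mem_finCongrSet (N : ℕ) (x : Ad k) : x ∈ finCongrSet k N ↔ finPart k x ∈ modSet k N := Iff.rfl

/-- `finCongrSet` is closed under multiplication. -/
theorem finCongrSet_mul_mem {N : ℕ} {x y : Ad k} (hx : x ∈ finCongrSet k N) (hy : y ∈ finCongrSet k N) :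
    x * y ∈ finCongrSet k N := by
  show finPart k (x * y) ∈ modSet k N
  rw [map_mul]
  exact mul_mem_modSet k hx hy

/-- **`A ≡ 1 (mod N)` in the finite components** for an adelic `4 × 4` matrix. -/
def IsCongrFin (N : ℕ) (A : M4 k) : Prop := ∀ i j, (A - 1) i j ∈ finCongrSet k N

/-- `1 ≡ 1`. -/
theorem IsCongrFin.one (N : ℕ) : IsCongrFin k N (1 : M4 k) := fun i j => by
  rw [sub_self]
  exact (finCongrSet k N).zero_mem

/-- the finite-part congruence condition is closed under products:
`A B − 1 = (A − 1)(B − 1) + (A − 1) + (B − 1)` (typer-2's `IsCongr.mul` verbatim). -/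
theorem IsCongrFin.mul {N : ℕ} {A B : M4 k} (hA : IsCongrFin k N A) (hB : IsCongrFin k N B) :
    IsCongrFin k N (A * B) := by
  intro i j
  have hprod : ∀ i j, ((A - 1) * (B - 1)) i j ∈ finCongrSet k N := by
    intro i j
    rw [Matrix.mul_apply]
    exact (finCongrSet k N).sum_mem fun x _ => finCongrSet_mul_mem k (hA i x) (hB x j)
  have hid : A * B - 1 = (A - 1) * (B - 1) + (A - 1) + (B - 1) := by noncomm_ring
  rw [hid, Matrix.add_apply, Matrix.add_apply]
  exact (finCongrSet k N).add_mem ((finCongrSet k N).add_mem (hprod i j) (hA i j)) (hB i j)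

/-- the adelic congruence condition implies the finite-part one. -/
theorem IsCongrFin.of_isCongr {N : ℕ} {A : M4 k} (hA : IsCongr k N A) : IsCongrFin k N A :=
  fun i j => (hA i j).2

/-- **the finite-part principal congruence subgroup of level `N` of `GL₄(𝔸_k)`**: `g ≡ 1` and `g⁻¹ ≡ 1 (mod N)` in the
finite components — «`K_f(N) × GL₄(k_∞)`». -/
def finLevelGL (N : ℕ) : Subgroup (GL4 k) where
  carrier := {g | IsCongrFin k N (g : M4 k) ∧ IsCongrFin k N ((g⁻¹ : GL4 k) : M4 k)}
  one_mem' := ⟨IsCongrFin.one k N, by simpa using IsCongrFin.one k N⟩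
  mul_mem' := by
    rintro g h ⟨hg, hg'⟩ ⟨hh, hh'⟩
    refine ⟨?_, ?_⟩
    · rw [Units.val_mul]; exact hg.mul k hh
    · rw [_root_.mul_inv_rev, Units.val_mul]; exact hh'.mul k hg'
  inv_mem' := by
    rintro g ⟨hg, hg'⟩
    exact ⟨hg', by rw [inv_inv]; exact hg⟩

variable {k} (W : PlaneData k)

/-- **`K_f(N) × G(k_∞) ≤ U(W)(𝔸_k)`**: the finite-part principal congruence subgroup of level `N` of the adelic
unitary group. -/
def finLevel (N : ℕ) : Subgroup (GA W) := (finLevelGL k N).subgroupOf (unitaryGroup W)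

/-- membership in `finLevel`. -/
theorem mem_finLevel (N : ℕ) (g : GA W) :
    g ∈ finLevel W N ↔ IsCongrFin k N (GA.mat W g) ∧ IsCongrFin k N (GA.mat W g⁻¹) := Iff.rfl

/-- **the carrier of `finLevel W N` is typer-2's `finCongr W N`** (the finite-part conditions of `K(N)`). -/
theorem coe_finLevel (N : ℕ) : (finLevel W N : Set (GA W)) = Common.finCongr W N := by
  ext g
  simp only [SetLike.mem_coe, mem_finLevel, Common.finCongr, Set.mem_setOf_eq, IsCongrFin, mem_finCongrSet]
  constructor
  · rintro ⟨h1, h2⟩ i j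
    exact ⟨h1 i j, h2 i j⟩
  · intro h
    exact ⟨fun i j => (h i j).1, fun i j => (h i j).2⟩

/-- **`finLevel W N` is OPEN in `U(W)(𝔸_k)`** (`N ≠ 0`): typer-2's `isOpen_finCongr`. -/
theorem isOpen_finLevel {N : ℕ} (hN : N ≠ 0) : IsOpen (finLevel W N : Set (GA W)) := by
  rw [coe_finLevel]
  exact isOpen_finCongr W hN

/-- `K(N) ≤ K_f(N) × G(k_∞)`. -/
theorem levelK_le_finLevel (N : ℕ) : levelK W N ≤ finLevel W N := by
  intro g hg
  obtain ⟨h1, h2⟩ := (mem_levelK W N g).1 hg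
  exact ⟨IsCongrFin.of_isCongr k h1, IsCongrFin.of_isCongr k h2⟩

/-- **the trace of `K_f(N) × G(k_∞)` on the finite part is `K(N)`**: `finLevel W N ⊓ finitePart W = levelK W N`
(typer-2's `preimage_levelK_eq` and `levelK_le_finitePart`). -/
theorem finLevel_inf_finitePart (N : ℕ) : finLevel W N ⊓ finitePart W = levelK W N := by
  ext g
  simp only [Subgroup.mem_inf]
  constructor
  · rintro ⟨hF, hfin⟩
    have h := Set.ext_iff.1 (preimage_levelK_eq W N) ⟨g, hfin⟩
    simp only [Set.mem_preimage, SetLike.mem_coe] at h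
    refine h.2 ?_
    have hF' : g ∈ (finLevel W N : Set (GA W)) := hF
    rw [coe_finLevel] at hF'
    exact hF'
  · intro hg
    exact ⟨levelK_le_finLevel W N hg, levelK_le_finitePart W N hg⟩

end FinLevel

section Indicator

variable {G : Type} [Group G] [TopologicalSpace G] [IsTopologicalGroup G]

/-- **the characteristic function of a compact open subgroup is a test function** — the honest shape of the level
function `ψ` of the instance theorems: a non-zero left-`K`-invariant test function exists exactly when the open `K` is
compact. -/
theorem isTest_indicator_of_compactOpen (K : Subgroup G) (hc : IsCompact (K : Set G)) (ho : IsOpen (K : Set G)) :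
    RTF.IsTest (Set.indicator (K : Set G) fun _ => (1 : ℂ)) := by
  have hcl : IsClosed (K : Set G) := K.isClosed_of_isOpen ho
  refine ⟨?_, ?_⟩
  · refine continuous_const.indicator fun a ha => ?_
    rw [IsClopen.frontier_eq ⟨hcl, ho⟩] at ha
    exact (Set.notMem_empty a ha).elim
  · exact HasCompactSupport.intro' hc hcl fun x hx => Set.indicator_of_notMem hx _

omit [TopologicalSpace G] [IsTopologicalGroup G] in
/-- the characteristic function of a subgroup is left-invariant under it. -/
theorem indicator_left_invariant (K : Subgroup G) :
    ∀ x ∈ K, ∀ g, Set.indicator (K : Set G) (fun _ => (1 : ℂ)) (x * g) =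
      Set.indicator (K : Set G) (fun _ => (1 : ℂ)) g := by
  intro x hx g
  by_cases hg : g ∈ K
  · rw [Set.indicator_of_mem (K.mul_mem hx hg), Set.indicator_of_mem hg]
  · rw [Set.indicator_of_notMem (by rwa [SetLike.mem_coe, K.mul_mem_cancel_left hx]),
      Set.indicator_of_notMem hg]

/-- **a compact open subgroup gives a genuine instance of the finite-rank left-`K`-type**: `1_K · (A ·) i j` for any
matrix-valued homomorphism `A` with continuous entries. -/
theorem hasFiniteRankLeftType_indicator_coeff (K : Subgroup G) (hc : IsCompact (K : Set G))
    (ho : IsOpen (K : Set G)) {d : ℕ} (A : G →* Matrix (Fin d) (Fin d) ℂ) (i j : Fin d)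
    (hA : ∀ l j, Continuous fun g => A g l j) :
    RTF.HasFiniteRankLeftType K (RTF.coeffFn A i j (Set.indicator (K : Set G) fun _ => (1 : ℂ))) :=
  RTF.hasFiniteRankLeftType_coeffFn K A i j _ (isTest_indicator_of_compactOpen K hc ho)
    (indicator_left_invariant K) hA

end Indicator

section Instance

variable {k : Type} [Field k] [NumberField k] (pl : PlaneData k) (hdef : IsDefinite pl) (hgen : IsGenuineRow pl)
  [MeasurableSpace (GA pl)] [BorelSpace (GA pl)] (R : RTFData pl) (μ : Measure (GA pl)) [μ.IsHaarMeasure]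
  [R.μT.IsHaarMeasure] [R.μT'.IsHaarMeasure] (hT : IsCompact (closure R.DT)) (hT' : IsCompact (closure R.DT'))
  {τ : ℕ → Set (GA pl → ℂ)} {φ : ℕ → GA pl → ℂ} {n : ℕ → ℕ}
  {Form : Type} [AddCommGroup Form] [Module ℂ Form] {A : FormAlgebra Form} {Wt : Witness A}

/-- **(S1b) IS A THEOREM FOR A FINITE-RANK LEFT-TYPE, on L1's instance** (the v0.38 shape `exists_spec_of_type`,
plan-1 S13630): for a family of test pairs whose FIRST tests have a finite-rank left-`K γ`-type for OPEN subgroups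
`K γ` of `U(W)(𝔸_k)`, every Hecke choice has a finite spectrum — t4-L1-p1's HeckeFinitenessType through
`exists_finset_specBlock_support_of_hasFiniteRankLeftType`; `[Countable Gk]` from `rationalPoints_countable`. -/
theorem exists_spec_of_finiteRankLeftType (hB : (Setting.ofAdelic pl hdef hgen R μ hT hT').IsAdaptedONB τ φ n)
    (tf : Wt.Translates → (GA pl → ℂ) × (GA pl → ℂ)) (K : Wt.Translates → Subgroup (GA pl))
    (hK : ∀ γ, IsOpen (K γ : Set (GA pl))) (htf₁ : ∀ γ, RTF.IsTest (tf γ).1)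
    (htype : ∀ γ, RTF.HasFiniteRankLeftType (K γ) (tf γ).1) :
    ∃ spec : Wt.Translates → Finset ℕ,
      FiniteSpectrum (Setting.ofAdelic pl hdef hgen R μ hT hT') R.chi R.chi' φ n tf spec := by
  haveI : Countable (Setting.ofAdelic pl hdef hgen R μ hT hT').Gk := rationalPoints_countable pl
  have h : ∀ γ, ∃ s : Finset ℕ, ∀ m ∉ s,
      (Setting.ofAdelic pl hdef hgen R μ hT hT').specBlock R.chi R.chi' φ n (tf γ).1 (tf γ).2 m = 0 := fun γ =>
    (Setting.ofAdelic pl hdef hgen R μ hT hT').exists_finset_specBlock_support_of_hasFiniteRankLeftType R.chi R.chi'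
      φ n (tf γ).1 (tf γ).2 (K γ) (hK γ) hB (htf₁ γ) (htype γ)
  choose spec hspec using h
  exact ⟨spec, fun γ m hm => hspec γ m hm⟩

/-- **(S1b) FOR «LEVEL-`N` FUNCTION × ARCHIMEDEAN MATRIX COEFFICIENT» PAIRS on L1's instance** (the theorem of record of
this file): if every first test `(tf γ).1` is `ψ γ · (archMat pl (w γ) ·) (i γ) (j γ)` with `ψ γ` a test function
left-invariant under `K_f(N γ) × G(k_∞)` (`N γ ≠ 0`), then every Hecke choice has a finite spectrum. -/
theorem exists_spec_of_archCoeff (hB : (Setting.ofAdelic pl hdef hgen R μ hT hT').IsAdaptedONB τ φ n)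
    (tf : Wt.Translates → (GA pl → ℂ) × (GA pl → ℂ)) (N : Wt.Translates → ℕ) (hN : ∀ γ, N γ ≠ 0)
    (w : Wt.Translates → InfinitePlace k) (i j : Wt.Translates → Fin 4) (ψ : Wt.Translates → GA pl → ℂ)
    (hψ : ∀ γ, RTF.IsTest (ψ γ)) (hψK : ∀ γ, ∀ x ∈ finLevel pl (N γ), ∀ g, ψ γ (x * g) = ψ γ g)
    (htf : ∀ γ, (tf γ).1 = RTF.coeffFn (archMat pl (w γ)) (i γ) (j γ) (ψ γ)) :
    ∃ spec : Wt.Translates → Finset ℕ,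
      FiniteSpectrum (Setting.ofAdelic pl hdef hgen R μ hT hT') R.chi R.chi' φ n tf spec :=
  exists_spec_of_finiteRankLeftType pl hdef hgen R μ hT hT' hB tf (fun γ => finLevel pl (N γ))
    (fun γ => isOpen_finLevel pl (hN γ))
    (fun γ => by
      rw [htf γ]
      exact RTF.isTest_coeffFn _ _ _ _ (hψ γ) (continuous_archMat_entry pl (w γ) _ _))
    (fun γ => by
      rw [htf γ]
      exact RTF.hasFiniteRankLeftType_coeffFn _ _ _ _ _ (hψ γ) (hψK γ)
        fun l j => continuous_archMat_entry pl (w γ) l j)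

end Instance

end Summit.Ventures.HodgeRepro.Tier4.Line1

end
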